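import Summits.BirchSwinnertonDyer.BirchSwinnertonDyer.Theorems.AlignedTransportAtTwoMainConjectureOfRankZeroBSDAtTwoCubicLayerOneParity
import Summits.BirchSwinnertonDyer.BirchSwinnertonDyer.Theorems.AlignedTransportAtTwoMainConjectureOfRankZeroBSDAtTwoCubicCarrierRoad
import Literature.NumberTheory.IwasawaTheory.Fukuda1994Thm1Proofs
import Literature.NumberTheory.IwasawaTheory.Fukuda1994Thm1RankProofs
import Literature.NumberTheory.NumberFields.CubicFieldOneRealPlace
import HarnessLib

/-!
# Route `AlignedTransportAtTwo`, crux C2 `MainConjectureOfRankZeroBSDAtTwo` (stmt-BirchSwinnertonDyer-22298):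
# THE KILFORD SEEDS' CUBIC TOWER — no layer-`(0,1)` certificate for `μ₂(ℚ(e₁)) = 0` when `2` splits completely in `ℚ(e₁)`, and
# THE LAYER-`(n, n+1)` DOORS into `MC₂(W)` modulo PRINT⁵ + MuIneqʳ (Fukuda 1994 Thm. 1, order and rank forms, his index `n₀ = 0` by parity)

HONEST FRAMING (cell `bsd-f1-sign2`, WIDTH-5 attached prover seat `bsd-line-att-p5` gen 25 on line `birth` of the lead `bsd-line-att-p2`;
`--supports` stmt-BirchSwinnertonDyer-22298, closes nothing; BSD is NOT proved by any of this; the crux C2, its verdict «blocked-on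
`Rank1Residual.GreenbergMuConjectureIrreducible`» and every registered stub are untouched). THEOREMS ONLY — no definition, no named fact,
no `sorry`; every arithmetic input is a DISPLAYED hypothesis. Sequel of `…CubicLayerOneParity` (this seat: `2 · h_K ∣ h(K(√2))` for `K` of odd
degree and unit rank `1` with three places above `2` of odd index) and of att-p5 g24's `…CubicCarrierRoad` (§2: `MC₂(W)` ⟸ PRINT⁵ + MuIneqʳ +
`μ₂(ℚ(β)^{cyc}) = 0` for a seed `W` with `Δ_W < 0`, `β = x(T)` a root of `4x³ + b₂x² + 2b₄x + b₆`).

WHY. All twelve certified seeds of the cell (`1727a1 4087c1 2071a1 4087a1 7831a1 9557a1 12261b1 19653d1 25861b1 25861e1 8035a1 24213c1`,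
`Theorems/ByReductionTypeAtTwoTowerClass<seed>.lean`) have `Δ_W ≡ 1 (mod 8)`: for a good ordinary `W` (`b₂` odd) the `2`-division cubic has
ONE root of valuation `−2` in `ℚ₂` and the other two generate `ℚ₂(√Δ_W)`, so `2` SPLITS COMPLETELY in `K = ℚ(e₁)` — three primes above `2`,
each of index `1` (seat memo `Cruxes/MainConjectureOfRankZeroBSDAtTwo/KILFORD-CUBIC-TOWER-att-p5-g25.md`; the dictionary itself is not
formalised here — «three primes above `2`» is the displayed hypothesis). Consequences, KERNEL:

* §3 (cubic currency, any cubic number field `F`): `units_rank_eq_one_of_nrRealPlaces_eq_one`; `ramificationIdx_eq_one_of_three_le_ncard`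
  (three primes above `2` ⟹ all unramified, `Σ eᵢfᵢ = 3`); `forall_totallyRamifiedFrom_zero_of_three_le_ncard` (Fukuda's index is `0`,
  tree p687770); **`classNumberPExp_zero_succ_le_one_of_cubic`** / **`classNumberPExp_one_ne_zero_of_cubic`** — for a COMPLEX cubic field in
  which `2` splits completely, `h(F(√2))` is EVEN whatever `h(F)` is (`e₁ ≥ e₀ + 1`).
* §4 (crux C2; `W` elliptic, `Δ_W < 0`, no rational `2`-torsion abscissa, `β` a root of the `2`-division cubic, three primes above `2` in
  `ℚ(β)`): `nrRealPlaces_adjoin_root_twoTorsionPolynomial_eq_one` (`disc = 16Δ_W < 0`); **`classNumberPExp_one_ne_zero_seedCubicField`** —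
  NO layer-`(0,1)` certificate exists: cell bsd-2adic's `AddKatoTwo.classicalMuVanishes_two_of_odd_discr_of_layerOne` (bit `e₁ = 0`) and
  Chevalley's door `AddKatoTwo.classNumberPExp_one_eq_zero_of_nonNorm_unit_two` (conclusion `e₁ = 0`, needs `≤ 2` primes above `2`) are void
  on every certified seed; **`mazurMainConjecture_two_of_muIneqRel_of_threePrimes_of_classNumberPExp_succ_eq`** and
  **`…_of_classGroupPRank_succ_eq`** — THE LAYER-`(n, n+1)` DOORS: PRINT⁵ {Kato 17.4 (1)(2) at `2`, Greenberg 4.1, period unit, modularity,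
  GZK} + MuIneqʳ (registered stub VERBATIM) + the cell hypotheses + three primes above `2` in `ℚ(β)` + ONE equality `e_{n+1} = e_n` (resp.
  `rank₂ Cl(ℚ(β)_{n+1}) = rank₂ Cl(ℚ(β)_n)`) for SOME `n` along the cyclotomic tower of `ℚ(β)` ⟹ `MC₂(W)` (Fukuda 1994 Thm. 1 (1)/(2), tree
  `_holds`, at `n₀ = 0`; g24 §2). By §3 the order equality needs `n ≥ 1` (`e₁ > e₀`), and so does the rank equality when `h(ℚ(β))` is odd:
  the certificate data of a Kilford seed are the `2`-class groups of `ℚ(e₁, √2)` (degree `6`) AND `ℚ(e₁)·ℚ(ζ₁₆)⁺` (degree `12`).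

Nothing is asserted about any seed's class groups; nothing is closed; BSD is not proved.

References: [Fukuda1994] Thm. 1 (1)(2), p. 264; [Lang1990] Ch. 13 §4, Lemma 4.1; [Washington1997] §13.1, Lemma 13.3; [NeukirchANT1999]
Ch. I §7 Thm. (7.4), §8 Prop. (8.2); [Cohen1993] Prop. 4.8.11; [Iwasawa1973MuInvariants] Thm. 2/3; [Kato2004Asterisque] Thm. 17.4;
[GreenbergLNM1716] Conj. 1.11, Thm. 4.1; [SilvermanAEC2009] III.§1; tree p739408 (att-p5 g24), p687770, p703318.
-/

set_option linter.dupNamespace false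
set_option autoImplicit false

noncomputable section

open scoped Classical NumberField nonZeroDivisors

namespace Summit.BirchSwinnertonDyer.BirchSwinnertonDyer.Theorems.AlignedTransportAtTwoCubicLayerOneDoors

open NumberField IsDedekindDomain
open Literature.NumberTheory.NumberFields Literature.NumberTheory.GaloisRepresentations Literature.NumberTheory.IwasawaTheory
  Literature.NumberTheory.EllipticCurves
  Summit.BirchSwinnertonDyer.BirchSwinnertonDyer.Theorems.AddKatoTwo
  Summit.BirchSwinnertonDyer.BirchSwinnertonDyer.Theorems.AlignedTransportAtTwoCubicLayerOneParity

/-! ## §3 Cubic currency: complex cubic fields with three primes above `2` -/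

section Cubic

variable (F : Type) [Field F] [NumberField F]

/-- **A cubic field with one real place has unit rank `1`** (`r₁ + 2 r₂ = 3`, `r₁ = 1` ⟹ `r₂ = 1`, `r = r₁ + r₂ − 1 = 1`).
[cite: NeukirchANT1999, Ch. I §7, Thm. (7.4)] -/
theorem units_rank_eq_one_of_nrRealPlaces_eq_one (hF : Module.finrank ℚ F = 3) (h1 : InfinitePlace.nrRealPlaces F = 1) :
    Units.rank F = 1 := by
  have h := InfinitePlace.card_add_two_mul_card_eq_rank (K := F)
  rw [hF, h1] at h
  have hc : InfinitePlace.nrComplexPlaces F = 1 := by omega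
  rw [Units.rank, InfinitePlace.card_eq_nrRealPlaces_add_nrComplexPlaces, h1, hc]

/-- **In a cubic field with (at least) THREE primes above `2`, every prime above `2` is unramified** (`Σ eᵢ fᵢ = 3` over at least three primes
forces `eᵢ = fᵢ = 1`), in particular has odd index. [cite: NeukirchANT1999, Ch. I §8, Prop. (8.2) (`Σ eᵢ fᵢ = n`)] -/
theorem ramificationIdx_eq_one_of_three_le_ncard (hF : Module.finrank ℚ F = 3)
    (h3 : 3 ≤ {v : HeightOneSpectrum (𝓞 F) | ((2 : ℕ) : 𝓞 F) ∈ v.asIdeal}.ncard)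
    (w : HeightOneSpectrum (𝓞 F)) (hw : ((2 : ℕ) : 𝓞 F) ∈ w.asIdeal) : w.asIdeal.ramificationIdx ℤ = 1 := by
  classical
  haveI : (Ideal.span {(2 : ℤ)}).IsMaximal :=
    Ideal.IsPrime.isMaximal ((Ideal.span_singleton_prime two_ne_zero).mpr Int.prime_two) (by simp)
  have h20 : (Ideal.span {(2 : ℤ)} : Ideal ℤ) ≠ ⊥ := by simp
  -- membership of a place `v ∋ 2` in the finset of primes over `(2)`
  have hmem : ∀ v : HeightOneSpectrum (𝓞 F), ((2 : ℕ) : 𝓞 F) ∈ v.asIdeal →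
      v.asIdeal ∈ IsDedekindDomain.primesOverFinset (Ideal.span {(2 : ℤ)}) (𝓞 F) := by
    intro v hv
    haveI : v.asIdeal.IsPrime := v.isPrime
    have hv2 : (2 : 𝓞 F) ∈ v.asIdeal := by exact_mod_cast hv
    have hvl : v.asIdeal.LiesOver (Ideal.span {(2 : ℤ)}) := by
      rw [Ideal.liesOver_span_iff v.isPrime.ne_top Int.prime_two, map_ofNat]; exact hv2
    exact (IsDedekindDomain.mem_primesOverFinset_iff h20 _).mpr ⟨v.isPrime, hvl⟩
  set S := IsDedekindDomain.primesOverFinset (Ideal.span {(2 : ℤ)}) (𝓞 F) with hSdef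
  -- `#S ≥ 3`
  have hS3 : 3 ≤ S.card := by
    have hinj : Set.InjOn (fun v : HeightOneSpectrum (𝓞 F) => v.asIdeal)
        {v : HeightOneSpectrum (𝓞 F) | ((2 : ℕ) : 𝓞 F) ∈ v.asIdeal} :=
      fun v _ v' _ h => HeightOneSpectrum.ext h
    have hle := Set.ncard_le_ncard_of_injOn (fun v : HeightOneSpectrum (𝓞 F) => v.asIdeal) (fun v hv => ?_) hinj
      (t := (S : Set (Ideal (𝓞 F)))) (Finset.finite_toSet S)
    · rw [Set.ncard_coe_finset] at hle
      exact h3.trans hle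
    · exact hmem v hv
  -- every term of `Σ_{P ∈ S} e_P f_P = 3` is `≥ 1`; the term at `w` is `e_w f_w`
  have hsum := Ideal.sum_ramification_inertia (R := ℤ) (𝓞 F) ℚ F (p := Ideal.span {(2 : ℤ)}) h20
  rw [hF] at hsum
  have hwS : w.asIdeal ∈ S := hmem w hw
  haveI : w.asIdeal.IsPrime := w.isPrime
  haveI hwl : w.asIdeal.LiesOver (Ideal.span {(2 : ℤ)}) := by
    have hw2 : (2 : 𝓞 F) ∈ w.asIdeal := by exact_mod_cast hw
    rw [Ideal.liesOver_span_iff w.isPrime.ne_top Int.prime_two, map_ofNat]; exact hw2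
  have hpos : ∀ P ∈ S, 1 ≤ Ideal.ramificationIdx' (Ideal.span {(2 : ℤ)}) P * Ideal.inertiaDeg' (Ideal.span {(2 : ℤ)}) P := by
    intro P hP
    obtain ⟨hPp, hPl⟩ := (IsDedekindDomain.mem_primesOverFinset_iff h20 _).mp hP
    haveI := hPp
    haveI := hPl
    have he : Ideal.ramificationIdx' (Ideal.span {(2 : ℤ)}) P ≠ 0 := Ideal.Factors.ramificationIdx_ne_zero (Ideal.span {(2 : ℤ)}) ⟨P, hP⟩
    have hf : 0 < Ideal.inertiaDeg' (Ideal.span {(2 : ℤ)}) P := Ideal.inertiaDeg'_pos _ P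
    exact Nat.one_le_iff_ne_zero.mpr (mul_ne_zero he hf.ne')
  -- `Σ = e_w f_w + Σ_{S ∖ w} ≥ e_w f_w + (#S - 1) ≥ e_w f_w + 2`
  have hsplit := Finset.add_sum_erase S
    (fun P => Ideal.ramificationIdx' (Ideal.span {(2 : ℤ)}) P * Ideal.inertiaDeg' (Ideal.span {(2 : ℤ)}) P) hwS
  have hrest : (S.erase w.asIdeal).card ≤
      ∑ P ∈ S.erase w.asIdeal, Ideal.ramificationIdx' (Ideal.span {(2 : ℤ)}) P * Ideal.inertiaDeg' (Ideal.span {(2 : ℤ)}) P := by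
    rw [Finset.card_eq_sum_ones]
    exact Finset.sum_le_sum fun P hP => hpos P (Finset.mem_of_mem_erase hP)
  have hcard : (S.erase w.asIdeal).card = S.card - 1 := Finset.card_erase_of_mem hwS
  have hf1 : 1 ≤ Ideal.inertiaDeg' (Ideal.span {(2 : ℤ)}) w.asIdeal := Ideal.inertiaDeg'_pos _ _
  have htot : Ideal.ramificationIdx' (Ideal.span {(2 : ℤ)}) w.asIdeal * Ideal.inertiaDeg' (Ideal.span {(2 : ℤ)}) w.asIdeal +
      ∑ P ∈ S.erase w.asIdeal, Ideal.ramificationIdx' (Ideal.span {(2 : ℤ)}) P * Ideal.inertiaDeg' (Ideal.span {(2 : ℤ)}) P = 3 :=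
    hsplit.trans hsum
  have hew : Ideal.ramificationIdx' (Ideal.span {(2 : ℤ)}) w.asIdeal * Ideal.inertiaDeg' (Ideal.span {(2 : ℤ)}) w.asIdeal ≤ 1 := by
    omega
  rw [← Ideal.ramificationIdx'_eq_ramificationIdx (Ideal.span {(2 : ℤ)}) w.asIdeal h20]
  have he1 : Ideal.ramificationIdx' (Ideal.span {(2 : ℤ)}) w.asIdeal ≤ 1 := by
    calc Ideal.ramificationIdx' (Ideal.span {(2 : ℤ)}) w.asIdeal
        ≤ Ideal.ramificationIdx' (Ideal.span {(2 : ℤ)}) w.asIdeal * Ideal.inertiaDeg' (Ideal.span {(2 : ℤ)}) w.asIdeal :=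
          Nat.le_mul_of_pos_right _ hf1
      _ ≤ 1 := hew
  have he0 := hpos w.asIdeal hwS
  have : Ideal.ramificationIdx' (Ideal.span {(2 : ℤ)}) w.asIdeal ≠ 0 := fun h => by rw [h, zero_mul] at he0; omega
  omega

/-- **Three primes above `2` in a cubic field ⟹ all three have odd index** (`e = 1`), in the currency of §2.
[cite: NeukirchANT1999, Ch. I §8, Prop. (8.2)] -/
theorem three_le_ncard_odd_of_three_le_ncard (hF : Module.finrank ℚ F = 3)
    (h3 : 3 ≤ {v : HeightOneSpectrum (𝓞 F) | ((2 : ℕ) : 𝓞 F) ∈ v.asIdeal}.ncard) :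
    3 ≤ {w : HeightOneSpectrum (𝓞 F) | ((2 : ℕ) : 𝓞 F) ∈ w.asIdeal ∧ Odd (w.asIdeal.ramificationIdx ℤ)}.ncard := by
  have heq : {w : HeightOneSpectrum (𝓞 F) | ((2 : ℕ) : 𝓞 F) ∈ w.asIdeal ∧ Odd (w.asIdeal.ramificationIdx ℤ)} =
      {v : HeightOneSpectrum (𝓞 F) | ((2 : ℕ) : 𝓞 F) ∈ v.asIdeal} := by
    ext w
    simp only [Set.mem_setOf_eq, and_iff_left_iff_imp]
    intro hw
    rw [ramificationIdx_eq_one_of_three_le_ncard F hF h3 w hw]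
    exact odd_one
  rw [heq]; exact h3

/-- **Three primes above `2` in a cubic field ⟹ Fukuda's index is `0`** for every cyclotomic `ℤ₂`-extension (all indices above `2` are
odd; tree `totallyRamifiedFrom_zero_of_forall_odd_ramificationIdx`, p687770). [cite: Fukuda1994, p. 264] [cite: Washington1997, §13.1 Lemma 13.3] -/
theorem forall_totallyRamifiedFrom_zero_of_three_le_ncard (hF : Module.finrank ℚ F = 3)
    (h3 : 3 ≤ {v : HeightOneSpectrum (𝓞 F) | ((2 : ℕ) : 𝓞 F) ∈ v.asIdeal}.ncard) :
    ∀ κ : ZpExtension F 2, κ.IsCyclotomic → TotallyRamifiedFrom κ 0 := fun κ hκ =>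
  totallyRamifiedFrom_zero_of_forall_odd_ramificationIdx (by rw [hF]; norm_num) κ hκ fun w hw => by
    rw [ramificationIdx_eq_one_of_three_le_ncard F hF h3 w hw]; exact odd_one

/-- **THE PARITY OBSTRUCTION, cubic currency.** `F` a cubic field with exactly ONE real place (a complex cubic field: negative
discriminant) and THREE primes above `2` (i.e. `2` splits completely): for every cyclotomic `ℤ₂`-extension `κ` of `F`,
`2 · h_F ∣ h(F(√2))`, `e₁(κ) ≥ e₀(κ) + 1`, in particular `e₁(κ) ≠ 0` — the class number of `F(√2)` is even, whatever `h_F` is.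
[cite: Lang1990, Ch. 13 §4, Lemma 4.1 (PDF p. 203)] [cite: Gras2003, II.6.2.3] [cite: Washington1997, §13.1] -/
theorem classNumberPExp_zero_succ_le_one_of_cubic (hF : Module.finrank ℚ F = 3) (h1 : InfinitePlace.nrRealPlaces F = 1)
    (h3 : 3 ≤ {v : HeightOneSpectrum (𝓞 F) | ((2 : ℕ) : 𝓞 F) ∈ v.asIdeal}.ncard)
    (κ : ZpExtension F 2) (hκ : κ.IsCyclotomic) : classNumberPExp κ 0 + 1 ≤ classNumberPExp κ 1 :=
  classNumberPExp_zero_succ_le_one (by rw [hF]; norm_num) (units_rank_eq_one_of_nrRealPlaces_eq_one F hF h1) κ hκ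
    (three_le_ncard_odd_of_three_le_ncard F hF h3)

/-- Corollary: `e₁(κ) ≠ 0` for such `F` — the bit displayed by the layer-`(0,1)` two-layer doors never holds.
[cite: Fukuda1994, Thm. 1 (1), p. 264] [cite: Lang1990, Ch. 13 §4, Lemma 4.1] -/
theorem classNumberPExp_one_ne_zero_of_cubic (hF : Module.finrank ℚ F = 3) (h1 : InfinitePlace.nrRealPlaces F = 1)
    (h3 : 3 ≤ {v : HeightOneSpectrum (𝓞 F) | ((2 : ℕ) : 𝓞 F) ∈ v.asIdeal}.ncard)
    (κ : ZpExtension F 2) (hκ : κ.IsCyclotomic) : classNumberPExp κ 1 ≠ 0 := by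
  have := classNumberPExp_zero_succ_le_one_of_cubic F hF h1 h3 κ hκ
  omega

end Cubic

/-! ## §4 Crux C2: the cubic `2`-torsion field of a seed-cell curve with `Δ_W < 0` in which `2` splits completely —
no layer-`(0,1)` certificate; THE LAYER-`(n, n+1)` DOORS (`n ≥ 1` in practice) into `MC₂(W)` modulo PRINT⁵ + MuIneqʳ -/

section Seed

open CongruenceSubgroup WeierstrassCurve Polynomial IntermediateField
  Literature.NumberTheory.EllipticCurves.ModularForms
  Literature.NumberTheory.EllipticCurves.Rank1Residual
  Literature.NumberTheory.EllipticCurves.Greenberg1999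
  Literature.NumberTheory.EllipticCurves.Module
  Summit.BirchSwinnertonDyer.Rank1Residual
  Summit.BirchSwinnertonDyer.Rank1Residual.X1.MuLambda
  Summit.BirchSwinnertonDyer.Rank1Residual.X5
  Summit.BirchSwinnertonDyer.Rank1Residual.F1Sign2
  Summit.BirchSwinnertonDyer.BirchSwinnertonDyer.Theorems.Rank1ResidualX1Defs
  Summit.BirchSwinnertonDyer.BirchSwinnertonDyer.Theses.AlignedTransportAtTwo
  Summit.BirchSwinnertonDyer.BirchSwinnertonDyer.Theorems.AlignedTransportAtTwoCubicCarrierRoad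

variable (W : WeierstrassCurve ℚ) [W.IsElliptic]

/-- **The cubic `2`-torsion field `ℚ(β)` of a curve with `Δ_W < 0` and irreducible `W[2]` has exactly ONE real place** (`β` a root of
the `2`-division cubic `4x³ + b₂x² + 2b₄x + b₆`, of discriminant `16 Δ_W < 0`; tree `nrRealPlaces_eq_one_of_cubic_discr_neg`).
[cite: Cohen1993, Prop. 4.8.11 and §4.1.3] [cite: SilvermanAEC2009, III.§1 (`disc ψ₂² = 16Δ`)] -/
theorem nrRealPlaces_adjoin_root_twoTorsionPolynomial_eq_one (hΔ : W.Δ < 0) (hirr : W.HasIrreducibleModPGaloisRep 2)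
    {β : AlgebraicClosure ℚ} (hβ : aeval β W.twoTorsionPolynomial.toPoly = 0) :
    haveI : FiniteDimensional ℚ ↥(IntermediateField.adjoin ℚ ({β} : Set (AlgebraicClosure ℚ))) :=
      IntermediateField.adjoin.finiteDimensional ((AlgebraicClosure.isAlgebraic ℚ).isAlgebraic β).isIntegral
    haveI : NumberField ↥(IntermediateField.adjoin ℚ ({β} : Set (AlgebraicClosure ℚ))) := NumberField.mk
    InfinitePlace.nrRealPlaces ↥(IntermediateField.adjoin ℚ ({β} : Set (AlgebraicClosure ℚ))) = 1 := by
  have hβint : IsIntegral ℚ β := ((AlgebraicClosure.isAlgebraic ℚ).isAlgebraic β).isIntegral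
  haveI : FiniteDimensional ℚ ↥(IntermediateField.adjoin ℚ ({β} : Set (AlgebraicClosure ℚ))) :=
    IntermediateField.adjoin.finiteDimensional hβint
  haveI : NumberField ↥(IntermediateField.adjoin ℚ ({β} : Set (AlgebraicClosure ℚ))) := NumberField.mk
  have h3 : Module.finrank ℚ ↥(IntermediateField.adjoin ℚ ({β} : Set (AlgebraicClosure ℚ))) = 3 :=
    AddKatoTwo.finrank_adjoin_root_twoTorsionPolynomial_eq_three W hirr hβ
  have hgen : aeval (IntermediateField.adjoin.powerBasis hβint).gen W.twoTorsionPolynomial.toPoly = 0 := by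
    rw [IntermediateField.adjoin.powerBasis_gen]
    apply (algebraMap ↥(IntermediateField.adjoin ℚ ({β} : Set (AlgebraicClosure ℚ))) (AlgebraicClosure ℚ)).injective
    rw [← Polynomial.aeval_algebraMap_apply, IntermediateField.AdjoinSimple.algebraMap_gen, map_zero, hβ]
  exact Literature.NumberTheory.NumberFields.nrRealPlaces_eq_one_of_cubic_discr_neg
    (IntermediateField.adjoin.powerBasis hβint) h3 (P := W.twoTorsionPolynomial) (four_ne_zero)
    (by rw [WeierstrassCurve.twoTorsionPolynomial_discr]; linarith) hgen

/-- **NO LAYER-`(0,1)` CERTIFICATE ON THE KILFORD SEEDS.** `W/ℚ` elliptic with `Δ_W < 0` and no rational `2`-torsion abscissa,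
`β` a root of the `2`-division cubic, and THREE primes above `2` in the cubic field `ℚ(β)` (i.e. `2` splits completely; for a
good ordinary `W` this is `Δ_W ≡ 1 (mod 8)`, the case of ALL twelve certified seeds of the cell): for every cyclotomic `ℤ₂`-extension
`κP` of `ℚ(β)`, `e₀(κP) + 1 ≤ e₁(κP)` and `e₁(κP) ≠ 0` — the class number of `ℚ(β, √2)` is even, so neither the two-layer parity door
(`e₀ = e₁ = 0`) nor Chevalley's non-norm-unit door (conclusion `e₁ = 0`) of cell bsd-2adic can certify `μ₂(ℚ(β)) = 0` for such a seed.
[cite: Lang1990, Ch. 13 §4, Lemma 4.1 (PDF p. 203)] [cite: Fukuda1994, Thm. 1 (1), p. 264] [cite: Washington1997, §13.1] -/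
theorem classNumberPExp_one_ne_zero_seedCubicField (hΔ : W.Δ < 0) (ht : ∀ x : ℚ, ¬ HasRationalTwoTorsionX W x)
    {β : AlgebraicClosure ℚ} (hβ : aeval β W.twoTorsionPolynomial.toPoly = 0)
    (h3p : 3 ≤ {v : HeightOneSpectrum (𝓞 ↥(IntermediateField.adjoin ℚ ({β} : Set (AlgebraicClosure ℚ)))) |
      ((2 : ℕ) : 𝓞 ↥(IntermediateField.adjoin ℚ ({β} : Set (AlgebraicClosure ℚ)))) ∈ v.asIdeal}.ncard)
    (κP : ZpExtension ↥(IntermediateField.adjoin ℚ ({β} : Set (AlgebraicClosure ℚ))) 2) (hκP : κP.IsCyclotomic) :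
    classNumberPExp κP 0 + 1 ≤ classNumberPExp κP 1 ∧ classNumberPExp κP 1 ≠ 0 := by
  have hirr := AlignedTransportAtTwoSeed.irr_two_of_forall_not_hasRationalTwoTorsionX W ht
  have hβint : IsIntegral ℚ β := ((AlgebraicClosure.isAlgebraic ℚ).isAlgebraic β).isIntegral
  haveI : FiniteDimensional ℚ ↥(IntermediateField.adjoin ℚ ({β} : Set (AlgebraicClosure ℚ))) :=
    IntermediateField.adjoin.finiteDimensional hβint
  haveI : NumberField ↥(IntermediateField.adjoin ℚ ({β} : Set (AlgebraicClosure ℚ))) := NumberField.mk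
  have h3 : Module.finrank ℚ ↥(IntermediateField.adjoin ℚ ({β} : Set (AlgebraicClosure ℚ))) = 3 :=
    AddKatoTwo.finrank_adjoin_root_twoTorsionPolynomial_eq_three W hirr hβ
  have h1 := nrRealPlaces_adjoin_root_twoTorsionPolynomial_eq_one W hΔ hirr hβ
  have hle := classNumberPExp_zero_succ_le_one_of_cubic _ h3 h1 h3p κP hκP
  exact ⟨hle, by omega⟩

variable [W.IsGloballyMinimal]

/-- **THE LAYER-`(n, n+1)` DOOR, ORDER FORM: `MC₂(W)` for a seed-cell `W` with `Δ_W < 0` whose cubic field has three primes above `2`,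
modulo PRINT⁵ + MuIneqʳ + ONE equality `e_{n+1} = e_n` of `2`-parts of class numbers along the cyclotomic tower of `ℚ(β)`.** PRINT {Kato
17.4 (1)(2) at `2` (`h17`), Greenberg 4.1 (`hGr`), period unit (`hper`), modularity (`hmod`), GZK (`hGZK`)} + MuIneqʳ (`hI`, the
registered stub VERBATIM) + the cell hypotheses + `β` a root of the `2`-division cubic + three primes above `2` in `ℚ(β)` (so Fukuda's
index is `0` by parity, §3) + for every cyclotomic `κP` SOME `n` with `e_{n+1}(κP) = e_n(κP)` (Fukuda 1994 Thm. 1 (1), tree `_holds`)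
⟹ `μ₂(ℚ(β)^{cyc}) = 0` ⟹ `MC₂(W)` (att-p5 g24 `…CubicCarrierRoad` §2). By the parity obstruction the equality can only hold with `n ≥ 1`
(`e₁ > e₀`): the data are the `2`-parts of `h(ℚ(β)(√2))` (degree `6`) and `h(ℚ(β)·ℚ(ζ₁₆)⁺)` (degree `12`), or higher.
[cite: Fukuda1994, Thm. 1 (1), p. 264] [cite: Kato2004Asterisque, Thm. 17.4 (1)(2) (p. 273)] [cite: GreenbergLNM1716, Thm. 4.1 (p. 102) and Conj. 1.11 (p. 58)]
[cite: Iwasawa1973MuInvariants, Thm. 2 and Thm. 3] -/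
theorem mazurMainConjecture_two_of_muIneqRel_of_threePrimes_of_classNumberPExp_succ_eq
    (h17 : ∀ [NeZero (W.conductorNorm ℤ)] (f : CuspForm (Gamma0 (W.conductorNorm ℤ)) 2),
      kato_divisibility_allPrimes W 2 (f := f))
    (hGr : Greenberg1999.thm41_charValue_rankZero_anyPrime)
    (hper : realPeriodRat_eq_unit_mul_plusPeriod_two) (hmod : nonempty_modularParametrizationData)
    (hGZK : rank_eq_analyticRank_of_analyticRank_le_one)
    (hI : ∀ (W : WeierstrassCurve ℚ) [W.IsElliptic] [W.IsGloballyMinimal], IsOrdinaryAt W 2 →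
      (∀ x : ℚ, ¬ HasRationalTwoTorsionX W x) →
      ∀ (κ : ZpExtension ℚ 2) (γ : Field.absoluteGaloisGroup ℚ), κ.IsCyclotomic →
      κ.IsTopGenerator γ → IsCyclotomicVariable 2 γ →
      ∀ ⦃N : ℕ⦄ [NeZero N] (f : CuspForm (Gamma0 N) 2), IsNewformOf W f →
      ∀ Gp : IwasawaAlgebra 2, iwasawaToPowerSeries 2 Gp = padicLFunction f (unitRoot W 2 : ℚ_[2]) →
      ∀ (D : W.SelmerDualData κ γ) (Yr : W.FineSelmerDualDataRelaxedInf κ γ),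
        lengthAt (IwasawaAlgebra 2) D.X ⟨IwasawaAlgebra.augIdealP 2, IwasawaAlgebra.isPrime_augIdealP_holds 2⟩ ≤
          lengthAt (IwasawaAlgebra 2) (IwasawaAlgebra 2 ⧸ Ideal.span {Gp})
              ⟨IwasawaAlgebra.augIdealP 2, IwasawaAlgebra.isPrime_augIdealP_holds 2⟩ +
            lengthAt (IwasawaAlgebra 2) Yr.X ⟨IwasawaAlgebra.augIdealP 2, IwasawaAlgebra.isPrime_augIdealP_holds 2⟩)
    (hord : IsOrdinaryAt W 2) (ht : ∀ x : ℚ, ¬ HasRationalTwoTorsionX W x) (hΔ : W.Δ < 0) (hr : W.analyticRank = 0)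
    (hμan : ∀ ⦃N : ℕ⦄ [NeZero N] (f : CuspForm (Gamma0 N) 2), IsNewformOf W f →
      ∀ G : IwasawaAlgebra 2, IsEvenBranchLiftAtTwo W f G → red G ≠ 0)
    (hbsd : BSDp W 2)
    {β : AlgebraicClosure ℚ} (hβ : aeval β W.twoTorsionPolynomial.toPoly = 0)
    (h3p : 3 ≤ {v : HeightOneSpectrum (𝓞 ↥(IntermediateField.adjoin ℚ ({β} : Set (AlgebraicClosure ℚ)))) |
      ((2 : ℕ) : 𝓞 ↥(IntermediateField.adjoin ℚ ({β} : Set (AlgebraicClosure ℚ)))) ∈ v.asIdeal}.ncard)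
    (hcert : ∀ κP : ZpExtension ↥(IntermediateField.adjoin ℚ ({β} : Set (AlgebraicClosure ℚ))) 2, κP.IsCyclotomic →
      ∃ n : ℕ, classNumberPExp κP (n + 1) = classNumberPExp κP n) :
    MazurMainConjecture W 2 := by
  have hirr := AlignedTransportAtTwoSeed.irr_two_of_forall_not_hasRationalTwoTorsionX W ht
  have hβint : IsIntegral ℚ β := ((AlgebraicClosure.isAlgebraic ℚ).isAlgebraic β).isIntegral
  haveI : FiniteDimensional ℚ ↥(IntermediateField.adjoin ℚ ({β} : Set (AlgebraicClosure ℚ))) :=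
    IntermediateField.adjoin.finiteDimensional hβint
  haveI : NumberField ↥(IntermediateField.adjoin ℚ ({β} : Set (AlgebraicClosure ℚ))) := NumberField.mk
  have h3 : Module.finrank ℚ ↥(IntermediateField.adjoin ℚ ({β} : Set (AlgebraicClosure ℚ))) = 3 :=
    AddKatoTwo.finrank_adjoin_root_twoTorsionPolynomial_eq_three W hirr hβ
  refine mazurMainConjecture_two_of_muIneqRel_of_classicalMu_cubicField_of_Δ_neg W h17 hGr hper hmod hGZK hI hord ht hΔ hr
    hμan hbsd hβ fun κP hκP => ?_
  obtain ⟨n, hn⟩ := hcert κP hκP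
  exact classicalMuVanishes_of_classNumberPExp_succ_eq fukuda1994_thm1_classNumberPExp_const_of_succ_eq_holds κP
    (forall_totallyRamifiedFrom_zero_of_three_le_ncard _ h3 h3p κP hκP) (Nat.zero_le n) hn

/-- **THE LAYER-`(n, n+1)` DOOR, RANK FORM**: the same with ONE equality of `2`-RANKS `rank₂ Cl(ℚ(β)_{n+1}) = rank₂ Cl(ℚ(β)_n)` along
the cyclotomic tower of `ℚ(β)` (Fukuda 1994 Thm. 1 (2) with its rider `μ = 0`, tree `_holds`). For `n = 0` and odd `h(ℚ(β))` the
equality is again impossible on such seeds (`rank₂ Cl(ℚ(β)(√2)) ≥ 1`, §2); with `n = 1` it asks for the `2`-ranks of the class groups of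
`ℚ(β)(√2)` and `ℚ(β)(√(2+√2))`. [cite: Fukuda1994, Thm. 1 (2), p. 264] [cite: Kato2004Asterisque, Thm. 17.4 (1)(2) (p. 273)]
[cite: GreenbergLNM1716, Thm. 4.1 (p. 102) and Conj. 1.11 (p. 58)] [cite: Iwasawa1973MuInvariants, Thm. 2 and Thm. 3] -/
theorem mazurMainConjecture_two_of_muIneqRel_of_threePrimes_of_classGroupPRank_succ_eq
    (h17 : ∀ [NeZero (W.conductorNorm ℤ)] (f : CuspForm (Gamma0 (W.conductorNorm ℤ)) 2),
      kato_divisibility_allPrimes W 2 (f := f))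
    (hGr : Greenberg1999.thm41_charValue_rankZero_anyPrime)
    (hper : realPeriodRat_eq_unit_mul_plusPeriod_two) (hmod : nonempty_modularParametrizationData)
    (hGZK : rank_eq_analyticRank_of_analyticRank_le_one)
    (hI : ∀ (W : WeierstrassCurve ℚ) [W.IsElliptic] [W.IsGloballyMinimal], IsOrdinaryAt W 2 →
      (∀ x : ℚ, ¬ HasRationalTwoTorsionX W x) →
      ∀ (κ : ZpExtension ℚ 2) (γ : Field.absoluteGaloisGroup ℚ), κ.IsCyclotomic →
      κ.IsTopGenerator γ → IsCyclotomicVariable 2 γ →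
      ∀ ⦃N : ℕ⦄ [NeZero N] (f : CuspForm (Gamma0 N) 2), IsNewformOf W f →
      ∀ Gp : IwasawaAlgebra 2, iwasawaToPowerSeries 2 Gp = padicLFunction f (unitRoot W 2 : ℚ_[2]) →
      ∀ (D : W.SelmerDualData κ γ) (Yr : W.FineSelmerDualDataRelaxedInf κ γ),
        lengthAt (IwasawaAlgebra 2) D.X ⟨IwasawaAlgebra.augIdealP 2, IwasawaAlgebra.isPrime_augIdealP_holds 2⟩ ≤
          lengthAt (IwasawaAlgebra 2) (IwasawaAlgebra 2 ⧸ Ideal.span {Gp})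
              ⟨IwasawaAlgebra.augIdealP 2, IwasawaAlgebra.isPrime_augIdealP_holds 2⟩ +
            lengthAt (IwasawaAlgebra 2) Yr.X ⟨IwasawaAlgebra.augIdealP 2, IwasawaAlgebra.isPrime_augIdealP_holds 2⟩)
    (hord : IsOrdinaryAt W 2) (ht : ∀ x : ℚ, ¬ HasRationalTwoTorsionX W x) (hΔ : W.Δ < 0) (hr : W.analyticRank = 0)
    (hμan : ∀ ⦃N : ℕ⦄ [NeZero N] (f : CuspForm (Gamma0 N) 2), IsNewformOf W f →
      ∀ G : IwasawaAlgebra 2, IsEvenBranchLiftAtTwo W f G → red G ≠ 0)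
    (hbsd : BSDp W 2)
    {β : AlgebraicClosure ℚ} (hβ : aeval β W.twoTorsionPolynomial.toPoly = 0)
    (h3p : 3 ≤ {v : HeightOneSpectrum (𝓞 ↥(IntermediateField.adjoin ℚ ({β} : Set (AlgebraicClosure ℚ)))) |
      ((2 : ℕ) : 𝓞 ↥(IntermediateField.adjoin ℚ ({β} : Set (AlgebraicClosure ℚ)))) ∈ v.asIdeal}.ncard)
    (hcert : ∀ κP : ZpExtension ↥(IntermediateField.adjoin ℚ ({β} : Set (AlgebraicClosure ℚ))) 2, κP.IsCyclotomic →
      ∃ n : ℕ, classGroupPRank κP (n + 1) = classGroupPRank κP n) :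
    MazurMainConjecture W 2 := by
  have hirr := AlignedTransportAtTwoSeed.irr_two_of_forall_not_hasRationalTwoTorsionX W ht
  have hβint : IsIntegral ℚ β := ((AlgebraicClosure.isAlgebraic ℚ).isAlgebraic β).isIntegral
  haveI : FiniteDimensional ℚ ↥(IntermediateField.adjoin ℚ ({β} : Set (AlgebraicClosure ℚ))) :=
    IntermediateField.adjoin.finiteDimensional hβint
  haveI : NumberField ↥(IntermediateField.adjoin ℚ ({β} : Set (AlgebraicClosure ℚ))) := NumberField.mk
  have h3 : Module.finrank ℚ ↥(IntermediateField.adjoin ℚ ({β} : Set (AlgebraicClosure ℚ))) = 3 :=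
    AddKatoTwo.finrank_adjoin_root_twoTorsionPolynomial_eq_three W hirr hβ
  refine mazurMainConjecture_two_of_muIneqRel_of_classicalMu_cubicField_of_Δ_neg W h17 hGr hper hmod hGZK hI hord ht hΔ hr
    hμan hbsd hβ fun κP hκP => ?_
  obtain ⟨n, hn⟩ := hcert κP hκP
  exact classicalMuVanishes_of_classGroupPRank_succ_eq fukuda1994_thm1_classGroupPRank_const_of_succ_eq_holds κP
    (forall_totallyRamifiedFrom_zero_of_three_le_ncard _ h3 h3p κP hκP) (Nat.zero_le n) hn

end Seed

end Summit.BirchSwinnertonDyer.BirchSwinnertonDyer.Theorems.AlignedTransportAtTwoCubicLayerOneDoors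

end
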